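import Summits.CriticalPhenomena.PercolationContinuityZ3.Theorems.PercNearOneGluingNoHeavyQuantFarSunCfgProducts
import Summits.CriticalPhenomena.PercolationContinuityZ3.Theorems.PercNearOneGluingNoHeavyLowerTailTwoCopyKronCheck
import HarnessLib

/-!
# FAR beyond trees: the KRONECKER checker for per-`K` configuration-level certificates (`HairyCycle.SunFAR K j`)

builds on p205010 (kernel theorem, internal audit signed; external expert review pending)

Support file (`--supports stmt-CriticalPhenomena-4575`), seat `prim-cert-1` (gen 26); memo `prim-cert-1/FROM-prim-cert-1-g26-CONFIG-CERTS.md` §7.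
`TK.sunFAR_of_fib` (`…QuantFarSunCfgCheck`) reduces `SunFAR K j` to the normalisation check and the nonnegativity of the fibre sums of the
block pair functions `TK.Gm`, and `TK.pairing_eq_Gm` (`…QuantFarSunCfgProducts`) writes each block pair function as a `TwoCopy.pairing` of
`4K+10` tabulated products.  An interpreted evaluation of the fibre sums is far too slow at `K = 8` (`1.6·10^8` pair evaluations); gen 18's
Kronecker checker `TwoCopy.twoCopyKronCheck` (`…LowerTailTwoCopyKronCheck`, after prim-cert-2's `OneCutCert` machinery) reads all of them off
ONE big integer per block, so that `native_decide` spends its time in GMP.  Since the `t`-side of every product depends on one copy only,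
the tables and their Kronecker numbers are computed ONCE per (coverage extent, factor) and shared by all blocks (`TK.Banks`):
* `TK.KRec`, `TK.NRec`, `TK.mkK`, `TK.mkN` — a table with its Kronecker number and its max;  `TK.kronPre` — `twoCopyKronCheck` on
  precomputed records, `TK.kronCheck_of_kronPre` (it implies the original check on the underlying tables);
* `TK.Banks`, `TK.mkBanks`, `TK.blockRecs` (+ `blockRecs_fst/snd/ok`) — the shared records of a block;
* `TK.kronBlock`, `TK.kronL` (shard: one prefix length `l`), `TK.kronAll` — the checker;  `TK.fib_nonneg_of_kronL`;
* **`TK.sunFAR_of_kronL`** / **`TK.sunFAR_of_kron`** — normalisation check + all shards (resp. `kronAll`) `= true` ⇒ `SunFAR K j`.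
No sorries; standard axioms; nothing here asserts anything about a particular certificate.  Elementary [this work].
-/

namespace Summit.CriticalPhenomena.PercolationContinuityZ3.Theorems.HairyCycle

namespace TK

open Finset
open Summit.CriticalPhenomena.PercolationContinuityZ3.Theorems.TwoCopy (fib pairing twoCopyCheck twoCopyKronCheck
  twoCopyCheck_of_kronCheck fib_nonneg_of_check)
open Summit.CriticalPhenomena.PercolationContinuityZ3.Theorems.OneCutCert (krN krZ maxNat maxAbs)

variable {K : ℕ}

/-! ## Tables with precomputed Kronecker numbers -/

/-- An integer table with its Kronecker number and its max `|·|`. [this work] -/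
structure KRec where
  /-- the table (length `2^m`) -/
  tab : List ℤ
  /-- `krZ s m tab` -/
  kr : ℤ
  /-- `maxAbs tab` -/
  mx : ℕ

/-- A natural table with its Kronecker number and its max. [this work] -/
structure NRec where
  /-- the table (length `2^m`) -/
  tab : List ℕ
  /-- `krN s m tab` -/
  kr : ℕ
  /-- `maxNat tab` -/
  mx : ℕ

/-- Record of the table of `f` on `[0, 2^m)`. [this work] -/
def mkK (s m : ℕ) (f : ℕ → ℤ) : KRec :=
  let tab := tabulate (2 ^ m) f
  ⟨tab, krZ s m tab, maxAbs tab⟩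

/-- Record of the table of `f` on `[0, 2^m)`. [this work] -/
def mkN (s m : ℕ) (f : ℕ → ℕ) : NRec :=
  let tab := tabulate (2 ^ m) f
  ⟨tab, krN s m tab, maxNat tab⟩

/-- Faithful record pairs (the stored numbers are those of the stored tables). [this work] -/
structure RecOK (s m : ℕ) (r : KRec × NRec) : Prop where
  /-- `kr` of the integer table -/
  kr1 : r.1.kr = krZ s m r.1.tab
  /-- `mx` of the integer table -/
  mx1 : r.1.mx = maxAbs r.1.tab
  /-- `kr` of the natural table -/
  kr2 : r.2.kr = krN s m r.2.tab
  /-- `mx` of the natural table -/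
  mx2 : r.2.mx = maxNat r.2.tab

/-- Records made by `mkK`, `mkN` are faithful. [this work] -/
theorem recOK_mk (s m : ℕ) (f : ℕ → ℤ) (g : ℕ → ℕ) : RecOK s m (mkK s m f, mkN s m g) :=
  ⟨rfl, rfl, rfl, rfl⟩

/-- `TwoCopy.twoCopyKronCheck` computed from precomputed records (same arithmetic, no table or Kronecker-number rebuilding). [this work] -/
def kronPre (m s : ℕ) (R : List (KRec × NRec)) (hL : List ℤ) (bL : List ℕ) : Bool :=
  let Z : ℤ := (R.map fun r => (r.2.kr : ℤ) * r.1.kr).sum - (krN s m bL : ℤ) * krZ s m hL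
  let off : ℤ := 2 ^ (s - 1) * (((2 : ℤ) ^ (s * 3 ^ m) - 1) / (2 ^ s - 1))
  let bnd : ℕ := 2 ^ m * ((R.map fun r => r.2.mx * r.1.mx).sum + maxNat bL * maxAbs hL)
  decide (0 < s) && (R.all fun r => r.1.tab.length = 2 ^ m) && decide (hL.length = 2 ^ m)
    && (R.all fun r => r.2.tab.length = 2 ^ m) && decide (bL.length = 2 ^ m)
    && decide (bnd < 2 ^ (s - 1))
    && decide (0 ≤ Z + off) && decide (((Z + off).toNat &&& off.toNat) = off.toNat)

/-- An `ofFn` over the indices of `R` reading the two table lists is a `map` over `R`. [folklore] -/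
theorem ofFn_getD_map {γ : Type} (R : List (KRec × NRec)) (F : List ℕ → List ℤ → γ) :
    (List.ofFn fun p : Fin R.length => F ((R.map fun r => r.2.tab).getD p []) ((R.map fun r => r.1.tab).getD p [])) =
      R.map fun r => F r.2.tab r.1.tab := by
  apply List.ext_getElem
  · simp
  · intro i h1 h2
    simp [List.getD_eq_getElem?_getD]

/-- **A passed `kronPre` on faithful records is a passed `twoCopyKronCheck` on the underlying tables.** [this work] -/
theorem kronCheck_of_kronPre {m s : ℕ} {R : List (KRec × NRec)} {hL : List ℤ} {bL : List ℕ} (hR : ∀ r ∈ R, RecOK s m r)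
    (h : kronPre m s R hL bL = true) :
    twoCopyKronCheck m R.length s (R.map fun r => r.1.tab) hL (R.map fun r => r.2.tab) bL = true := by
  unfold kronPre at h
  simp only [Bool.and_eq_true, decide_eq_true_eq, List.all_eq_true] at h
  obtain ⟨⟨⟨⟨⟨⟨⟨hs, ht⟩, hhlen⟩, ha⟩, hblen⟩, hbnd⟩, hZoff⟩, hland⟩ := h
  have eZ : (List.ofFn fun p : Fin R.length => (krN s m ((R.map fun r => r.2.tab).getD p []) : ℤ) *
      krZ s m ((R.map fun r => r.1.tab).getD p [])).sum = (R.map fun r => (r.2.kr : ℤ) * r.1.kr).sum := by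
    rw [ofFn_getD_map R (fun a t => (krN s m a : ℤ) * krZ s m t)]
    congr 1
    refine List.map_congr_left fun r hr => ?_
    obtain ⟨h1, -, h3, -⟩ := hR r hr
    rw [h1, h3]
  have eB : (List.ofFn fun p : Fin R.length => maxNat ((R.map fun r => r.2.tab).getD p []) *
      maxAbs ((R.map fun r => r.1.tab).getD p [])).sum = (R.map fun r => r.2.mx * r.1.mx).sum := by
    rw [ofFn_getD_map R (fun a t => maxNat a * maxAbs t)]
    congr 1
    refine List.map_congr_left fun r hr => ?_
    obtain ⟨-, h2, -, h4⟩ := hR r hr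
    rw [h2, h4]
  unfold twoCopyKronCheck
  simp only [Bool.and_eq_true, decide_eq_true_eq, List.all_eq_true, List.length_map, List.mem_map]
  rw [eZ, eB]
  refine ⟨⟨⟨⟨⟨⟨⟨⟨⟨hs, trivial⟩, ?_⟩, hhlen⟩, trivial⟩, ?_⟩, hblen⟩, hbnd⟩, hZoff⟩, hland⟩
  · rintro l ⟨r, hr, rfl⟩; exact ht r hr
  · rintro l ⟨r, hr, rfl⟩; exact ha r hr

/-! ## Shared record banks -/

/-- The records of all factor tables, by coverage extent: forward `t`-side `FT[l][u]` and backward `a`-side `BA[m][v]` (they depend on a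
coverage mask), forward `a`-side `FA[g][g']` and backward `t`-side `BT[g][g']` (they depend on a ghost extent). [this work] -/
structure Banks where
  /-- forward `t`-records by `(l, u)` -/
  FT : Array (Array (List KRec))
  /-- forward `a`-records by `(g, g')` -/
  FA : Array (Array (List NRec))
  /-- backward `t`-records by `(g, g')` -/
  BT : Array (Array (List KRec))
  /-- backward `a`-records by `(m, v)` -/
  BA : Array (Array (List NRec))

/-- Building the banks (`(K+2)(K+1)(4K+10)` tables of length `2^K` and their Kronecker numbers, once). [this work] -/
def mkBanks (K j s : ℕ) (t : NTabs) : Banks where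
  FT := Array.ofFn fun l : Fin (K + 2) => Array.ofFn fun u : Fin (K + 1) => (fwdT K j (covM K l u)).map (mkK s K)
  FA := Array.ofFn fun g : Fin (K + 2) => Array.ofFn fun g' : Fin (K + 1) => (fwdA K t g g').map (mkN s K)
  BT := Array.ofFn fun g : Fin (K + 2) => Array.ofFn fun g' : Fin (K + 1) => (bwdT K j t g g').map (mkK s K)
  BA := Array.ofFn fun m : Fin (K + 2) => Array.ofFn fun v : Fin (K + 1) => (bwdA K j (covM K m v)).map (mkN s K)

/-- The record pairs of the block `(l, m, u, v)` (aligned with `TK.blockTerms`). [this work] -/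
def blockRecs (B : Banks) (l m u v : ℕ) : List (KRec × NRec) :=
  List.zip ((B.FT.getD l #[]).getD u []) ((B.FA.getD m #[]).getD v []) ++
    List.zip ((B.BT.getD l #[]).getD u []) ((B.BA.getD m #[]).getD v []) ++
    (List.zip ((B.FT.getD l #[]).getD v []) ((B.FA.getD m #[]).getD u []) ++
      List.zip ((B.BT.getD l #[]).getD v []) ((B.BA.getD m #[]).getD u []))

variable {am : ℕ → ℕ → ℕ → ℕ → ℕ} {bm : ℕ → ℕ → ℕ → ℕ} {j s : ℕ}

/-- `zip` of mapped lists, mapped. [folklore] -/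
theorem map_zip_map {α β α' β' γ : Type} (l1 : List α) (l2 : List β) (f : α → α') (g : β → β') (h : α' × β' → γ) :
    (List.zip (l1.map f) (l2.map g)).map h = (List.zip l1 l2).map fun x => h (f x.1, g x.2) := by
  rw [List.zip_map, List.map_map]
  rfl

/-- The block records, unfolded. [this work] -/
theorem blockRecs_mk {l m u v : ℕ} (hl : l < K + 2) (hm : m < K + 2) (hu : u < K + 1) (hv : v < K + 1) (t : NTabs) :
    blockRecs (mkBanks K j s t) l m u v =
      List.zip ((fwdT K j (covM K l u)).map (mkK s K)) ((fwdA K t m v).map (mkN s K)) ++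
        List.zip ((bwdT K j t l u).map (mkK s K)) ((bwdA K j (covM K m v)).map (mkN s K)) ++
        (List.zip ((fwdT K j (covM K l v)).map (mkK s K)) ((fwdA K t m u).map (mkN s K)) ++
          List.zip ((bwdT K j t l v).map (mkK s K)) ((bwdA K j (covM K m u)).map (mkN s K))) := by
  unfold blockRecs mkBanks
  simp only [getD_ofFn _ _ hl, getD_ofFn _ _ hm, getD_ofFn _ _ hu, getD_ofFn _ _ hv]

/-- First tables of the block records = tabulated `t`-factors of `blockTerms`. [this work] -/
theorem blockRecs_fst {l m u v : ℕ} (hl : l < K + 2) (hm : m < K + 2) (hu : u < K + 1) (hv : v < K + 1) (t : NTabs) :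
    (blockRecs (mkBanks K j s t) l m u v).map (fun r => r.1.tab) = (blockTerms K j t l m u v).map fun x => tabulate (2 ^ K) x.1 := by
  rw [blockRecs_mk hl hm hu hv]
  unfold blockTerms
  simp only [List.map_append, map_zip_map, fwd_eq_zip, bwd_eq_zip]
  rfl

/-- Second tables of the block records = tabulated `a`-factors of `blockTerms`. [this work] -/
theorem blockRecs_snd {l m u v : ℕ} (hl : l < K + 2) (hm : m < K + 2) (hu : u < K + 1) (hv : v < K + 1) (t : NTabs) :
    (blockRecs (mkBanks K j s t) l m u v).map (fun r => r.2.tab) = (blockTerms K j t l m u v).map fun x => tabulate (2 ^ K) x.2 := by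
  rw [blockRecs_mk hl hm hu hv]
  unfold blockTerms
  simp only [List.map_append, map_zip_map, fwd_eq_zip, bwd_eq_zip]
  rfl

/-- Members of a `zip` of record lists made by `mkK`, `mkN` are faithful. [this work] -/
theorem recOK_of_mem_zip {L1 : List (ℕ → ℤ)} {L2 : List (ℕ → ℕ)} {r : KRec × NRec}
    (h : r ∈ List.zip (L1.map (mkK s K)) (L2.map (mkN s K))) : RecOK s K r := by
  have h1 := List.of_mem_zip h
  obtain ⟨⟨f, -, hf⟩, ⟨g, -, hg⟩⟩ := And.intro (List.mem_map.1 h1.1) (List.mem_map.1 h1.2)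
  obtain ⟨r1, r2⟩ := r
  simp only at hf hg
  subst hf; subst hg
  exact recOK_mk s K f g

/-- The block records are faithful. [this work] -/
theorem blockRecs_ok {l m u v : ℕ} (hl : l < K + 2) (hm : m < K + 2) (hu : u < K + 1) (hv : v < K + 1) (t : NTabs) :
    ∀ r ∈ blockRecs (mkBanks K j s t) l m u v, RecOK s K r := by
  intro r hr
  rw [blockRecs_mk hl hm hu hv] at hr
  simp only [List.mem_append] at hr
  rcases hr with (hr | hr) | (hr | hr) <;> exact recOK_of_mem_zip hr

/-! ## The checker -/

/-- THE KRONECKER CHECK of one block (base `2^s`), on the shared records. [this work] -/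
def kronBlock (K s : ℕ) (B : Banks) (l m u v : ℕ) : Bool :=
  kronPre K s (blockRecs B l m u v) (List.replicate (2 ^ K) 0) (List.replicate (2 ^ K) 0)

/-- THE KRONECKER CHECK of the blocks with prefix length `l` (all `m ≤ l`, `u ≤ v ≤ K`) — the unit of sharding. [this work] -/
def kronL (K s : ℕ) (B : Banks) (l : ℕ) : Bool :=
  (List.range (l + 1)).all fun m => (List.range (K + 1)).all fun v => (List.range (v + 1)).all fun u => kronBlock K s B l m u v

/-- THE KRONECKER CHECK of all blocks `m ≤ l ≤ K+1`, `u ≤ v ≤ K`. [this work] -/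
def kronAll (K j s : ℕ) (am : ℕ → ℕ → ℕ → ℕ → ℕ) (bm : ℕ → ℕ → ℕ → ℕ) : Bool :=
  let B := mkBanks K j s (mkNTabs K am bm)
  (List.range (K + 2)).all fun l => kronL K s B l

/-! ## Soundness -/

/-- **Soundness of the sharded Kronecker check**: every fibre sum of every block pair function is nonnegative. [this work] -/
theorem fib_nonneg_of_kronL (h : ∀ l, l < K + 2 → kronL K s (mkBanks K j s (mkNTabs K am bm)) l = true) :
    ∀ l m u v : ℕ, m ≤ l → l ≤ K + 1 → u ≤ v → v ≤ K →
      ∀ z t : ℕ, z < 2 ^ K → t < 2 ^ K → z &&& t = 0 → 0 ≤ fib K (Gm K j am bm l m u v) z t := by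
  intro l m u v hml hl huv hv z t hz ht hzt
  have h1 := h l (by omega)
  unfold kronL at h1
  simp only [List.all_eq_true, List.mem_range] at h1
  have hb := h1 m (by omega) v (by omega) u (by omega)
  unfold kronBlock at hb
  have hk := kronCheck_of_kronPre (blockRecs_ok (j := j) (s := s) (by omega) (by omega) (by omega) (by omega) (mkNTabs K am bm)) hb
  have hlen : (blockRecs (mkBanks K j s (mkNTabs K am bm)) l m u v).length = (blockTerms K j (mkNTabs K am bm) l m u v).length := by
    rw [← List.length_map (f := fun r : KRec × NRec => r.1.tab), blockRecs_fst (by omega) (by omega) (by omega) (by omega), List.length_map]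
  rw [blockRecs_fst (by omega) (by omega) (by omega) (by omega), blockRecs_snd (by omega) (by omega) (by omega) (by omega), hlen] at hk
  have hf := fib_nonneg_of_check (twoCopyCheck_of_kronCheck hk) hz ht hzt
  rwa [fib_congr (fun c1 c2 hc1 hc2 => pairing_eq_Gm K j (am := am) (bm := bm) (by omega) (by omega) (by omega) (by omega) hc1 hc2)
    hz ht] at hf

/-- **`SunFAR K j` from a mask-level certificate by the SHARDED Kronecker check** (`K ≥ 2`): the normalisation check and
`kronL … l = true` for every `l < K+2` (each provable by `native_decide`, in as many files as convenient). [this work] -/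
theorem sunFAR_of_kronL (hK : 2 ≤ K) (am : ℕ → ℕ → ℕ → ℕ → ℕ) (bm : ℕ → ℕ → ℕ → ℕ) {s : ℕ}
    (hN : checkN K j am = true) (hL : ∀ l, l < K + 2 → kronL K s (mkBanks K j s (mkNTabs K am bm)) l = true) : SunFAR K j :=
  sunFAR_of_fib hK am bm hN (fib_nonneg_of_kronL hL)

/-- **`SunFAR K j` from a mask-level certificate by the Kronecker check** (`K ≥ 2`): `checkN K j am = true` (normalisation) and
`kronAll K j s am bm = true` (core inequality, any base `2^s`) give FAR at layer `j` on the sun graph with `K` hairs, all weights.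
Intended use: both by `native_decide` in a certificate file. [this work] -/
theorem sunFAR_of_kron (hK : 2 ≤ K) (am : ℕ → ℕ → ℕ → ℕ → ℕ) (bm : ℕ → ℕ → ℕ → ℕ) {s : ℕ}
    (hN : checkN K j am = true) (hC : kronAll K j s am bm = true) : SunFAR K j := by
  refine sunFAR_of_kronL (s := s) hK am bm hN fun l hl => ?_
  unfold kronAll at hC
  simp only [List.all_eq_true, List.mem_range] at hC
  exact hC l hl

end TK

end Summit.CriticalPhenomena.PercolationContinuityZ3.Theorems.HairyCycle
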